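import Mathlib
import Summits.MatrixMultiplication.MatrixMultiplication.Theorems.FidelityWitnessesDiagonalPowerDecayStubMatMulIsFlat

/-!
# The monotone (cancellation-free) regime of `stub_nonnegFlatDecay` and of the crux `DiagonalPowerDecay`
# (line `unit-tensor-orbit-nuclear-ratio`, stmt-MatrixMultiplication-14053)

Lead prover-line-stmt-MatrixMultiplication-14053-1.  The open stub asks for a power saving
`|⟨S,Y⟩|² ≤ c·N^{3/2−δ}·‖S‖²` for flat non-negative targets `Y` and (border-)rank-`N` tensors `S`.  THIS FILE settles the
NO-CANCELLATION regime with the optimal exponent: if `S = Σ_{l<r} a_l ⊗ b_l ⊗ c_l` is a sum of `r` triads with ENTRYWISE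
NON-NEGATIVE REAL factors, then for EVERY flat target `Y` (non-negativity of `Y` not needed)

  `|⟨S,Y⟩|² ≤ r · ‖S‖²`     (`capture_le_card_of_nonneg_frame`, registered sub-goal, def-free),

i.e. the stub holds on the monotone cone with `c = 1`, `δ = 1/2` at `r = N`.  Proof: nuclear duality
`|⟨S,Y⟩| ≤ Σ_l ‖a_l‖‖b_l‖‖c_l‖` (flatness, triad by triad), Cauchy–Schwarz `(Σ_l p_l)² ≤ r Σ_l p_l²`, and — the only place
non-negativity enters — `Σ_l ‖a_l‖²‖b_l‖²‖c_l‖² = Σ_{ijk} Σ_l (a_{li} b_{lj} c_{lk})² ≤ Σ_{ijk} (Σ_l a_{li} b_{lj} c_{lk})² = ‖S‖²`.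
For the matrix multiplication tensor (flat: `stub_matMul_isFlat`, p96489) this is the statement that MONOTONE bilinear
approximation schemes with `n²` products capture at most the fraction `n²/n³ = 1/n` of `⟨n,n,n⟩`
(`matMul_capture_le_of_nonneg_frame`), which is SHARP (the slice `⟨n,1,n⟩`: `n²` disjoint products of `T` itself): the
crux's conjectured power saving `δ > 0` over the trivial `δ = 0` is thus exactly a statement about CANCELLING
(signed / complex, border-type) frames — cf. `M(2,4) = 3+√2 > 4` is already a border phenomenon (Disproof § NUMERICS).
No facts assumed.
-/

-- the tree's namespace `Summit.MatrixMultiplication.MatrixMultiplication.…` repeats a component by design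
set_option linter.dupNamespace false

noncomputable section

namespace Summit.MatrixMultiplication.MatrixMultiplication.Theorems.DiagonalPowerDecay

namespace PositiveFrame

open scoped BigOperators
open Literature.Computability.AlgebraicComplexity

variable {ι : Type} [Fintype ι] {r : ℕ}

/-- For non-negative factors, `Σ_l (a_{li} b_{lj} c_{lk})² ≤ (Σ_l a_{li} b_{lj} c_{lk})²` entrywise. -/
theorem sum_sq_le_sq_sum {x : Fin r → ℝ} (hx : ∀ l, 0 ≤ x l) : (∑ l, x l ^ 2) ≤ (∑ l, x l) ^ 2 := by
  rw [sq, Finset.sum_mul_sum]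
  refine Finset.sum_le_sum fun l _ => ?_
  rw [sq]
  calc x l * x l = ∑ m ∈ ({l} : Finset (Fin r)), x l * x m := by simp
    _ ≤ ∑ m, x l * x m :=
        Finset.sum_le_sum_of_subset_of_nonneg (Finset.subset_univ _) fun m _ _ => mul_nonneg (hx l) (hx m)

/-- The diagonal of the Gram cube is dominated by `‖S‖²` when the factors are non-negative:
`Σ_l ‖a_l‖²‖b_l‖²‖c_l‖² ≤ Σ_{ijk} S_{ijk}²`. -/
theorem sum_normSq_triads_le (a b c : Fin r → ι → ℝ) (ha : ∀ l i, 0 ≤ a l i) (hb : ∀ l j, 0 ≤ b l j)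
    (hc : ∀ l k, 0 ≤ c l k) :
    (∑ l, (∑ i, a l i ^ 2) * (∑ j, b l j ^ 2) * (∑ k, c l k ^ 2)) ≤ ∑ i, ∑ j, ∑ k, (∑ l, a l i * b l j * c l k) ^ 2 := by
  -- expand the left side as `Σ_l Σ_{ijk} (a b c)²` and swap
  have hexp : ∀ l, (∑ i, a l i ^ 2) * (∑ j, b l j ^ 2) * (∑ k, c l k ^ 2) =
      ∑ i, ∑ j, ∑ k, (a l i * b l j * c l k) ^ 2 := by
    intro l
    rw [Finset.sum_mul_sum, Finset.sum_mul]
    refine Finset.sum_congr rfl fun i _ => ?_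
    rw [Finset.sum_mul]
    refine Finset.sum_congr rfl fun j _ => ?_
    rw [Finset.mul_sum]
    refine Finset.sum_congr rfl fun k _ => ?_
    ring
  simp only [hexp]
  -- swap `Σ_l` inside
  rw [Finset.sum_comm]
  refine Finset.sum_le_sum fun i _ => ?_
  rw [Finset.sum_comm]
  refine Finset.sum_le_sum fun j _ => ?_
  rw [Finset.sum_comm]
  refine Finset.sum_le_sum fun k _ => ?_
  exact sum_sq_le_sq_sum fun l => mul_nonneg (mul_nonneg (ha l i) (hb l j)) (hc l k)

/-- **Monotone frames capture at most `r·‖S‖²` of any flat target.**  For `S = Σ_{l<r} a_l⊗b_l⊗c_l` with entrywise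
non-negative real factors and any flat `Y`: `|⟨S,Y⟩|² ≤ r·‖S‖²`. -/
theorem capture_le (Y : ι → ι → ι → ℂ)
    (hY : ∀ w u v : ι → ℂ, ‖∑ i, ∑ j, ∑ k, w i * u j * v k * Y i j k‖ ≤
      Real.sqrt (∑ i, ‖w i‖ ^ 2) * Real.sqrt (∑ j, ‖u j‖ ^ 2) * Real.sqrt (∑ k, ‖v k‖ ^ 2))
    (a b c : Fin r → ι → ℝ) (ha : ∀ l i, 0 ≤ a l i) (hb : ∀ l j, 0 ≤ b l j) (hc : ∀ l k, 0 ≤ c l k) :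
    ‖∑ i, ∑ j, ∑ k, ((∑ l, a l i * b l j * c l k : ℝ) : ℂ) * Y i j k‖ ^ 2 ≤ r * ∑ i, ∑ j, ∑ k, (∑ l, a l i * b l j * c l k) ^ 2 := by
  -- triad norms
  let p : Fin r → ℝ := fun l =>
    Real.sqrt (∑ i, a l i ^ 2) * Real.sqrt (∑ j, b l j ^ 2) * Real.sqrt (∑ k, c l k ^ 2)
  have hp0 : ∀ l, 0 ≤ p l := fun l =>
    mul_nonneg (mul_nonneg (Real.sqrt_nonneg _) (Real.sqrt_nonneg _)) (Real.sqrt_nonneg _)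
  -- Step 1: split the overlap over the triads
  have hsplit : (∑ i, ∑ j, ∑ k, ((∑ l, a l i * b l j * c l k : ℝ) : ℂ) * Y i j k) =
      ∑ l, ∑ i, ∑ j, ∑ k, ((a l i : ℂ) * (b l j : ℂ) * (c l k : ℂ)) * Y i j k := by
    push_cast
    simp only [Finset.sum_mul]
    -- `Σ_i Σ_j Σ_k Σ_l = Σ_l Σ_i Σ_j Σ_k`
    calc (∑ i, ∑ j, ∑ k, ∑ l, (a l i : ℂ) * (b l j : ℂ) * (c l k : ℂ) * Y i j k)
        = ∑ i, ∑ j, ∑ l, ∑ k, (a l i : ℂ) * (b l j : ℂ) * (c l k : ℂ) * Y i j k :=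
          Finset.sum_congr rfl fun i _ => Finset.sum_congr rfl fun j _ => Finset.sum_comm
      _ = ∑ i, ∑ l, ∑ j, ∑ k, (a l i : ℂ) * (b l j : ℂ) * (c l k : ℂ) * Y i j k :=
          Finset.sum_congr rfl fun i _ => Finset.sum_comm
      _ = ∑ l, ∑ i, ∑ j, ∑ k, (a l i : ℂ) * (b l j : ℂ) * (c l k : ℂ) * Y i j k := Finset.sum_comm
  -- Step 2: flatness triad by triad: `|⟨S,Y⟩| ≤ Σ_l p_l`
  have hsq : ∀ (x : ι → ℝ), (∑ i, ‖(x i : ℂ)‖ ^ 2) = ∑ i, x i ^ 2 := fun x =>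
    Finset.sum_congr rfl fun i _ => by rw [Complex.norm_real, Real.norm_eq_abs, sq_abs]
  have hcost : ‖∑ i, ∑ j, ∑ k, ((∑ l, a l i * b l j * c l k : ℝ) : ℂ) * Y i j k‖ ≤ ∑ l, p l := by
    rw [hsplit]
    refine (norm_sum_le _ _).trans (Finset.sum_le_sum fun l _ => ?_)
    have := hY (fun i => (a l i : ℂ)) (fun j => (b l j : ℂ)) (fun k => (c l k : ℂ))
    rwa [hsq, hsq, hsq] at this
  -- Step 3: Cauchy–Schwarz `(Σ p)² ≤ r Σ p²` and `Σ p² ≤ ‖S‖²`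
  have hcs : (∑ l, p l) ^ 2 ≤ r * ∑ l, p l ^ 2 := by
    have := sq_sum_le_card_mul_sum_sq (s := (Finset.univ : Finset (Fin r))) (f := p)
    simpa using this
  have hpsq : ∀ l, p l ^ 2 = (∑ i, a l i ^ 2) * (∑ j, b l j ^ 2) * (∑ k, c l k ^ 2) := by
    intro l
    simp only [p, mul_pow, Real.sq_sqrt (Finset.sum_nonneg fun _ _ => sq_nonneg _)]
  have hdiag : (∑ l, p l ^ 2) ≤ ∑ i, ∑ j, ∑ k, (∑ l, a l i * b l j * c l k) ^ 2 := by
    simp only [hpsq]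
    exact sum_normSq_triads_le a b c ha hb hc
  calc ‖∑ i, ∑ j, ∑ k, ((∑ l, a l i * b l j * c l k : ℝ) : ℂ) * Y i j k‖ ^ 2
      ≤ (∑ l, p l) ^ 2 := pow_le_pow_left₀ (norm_nonneg _) hcost 2
    _ ≤ r * ∑ l, p l ^ 2 := hcs
    _ ≤ r * ∑ i, ∑ j, ∑ k, (∑ l, a l i * b l j * c l k) ^ 2 :=
        mul_le_mul_of_nonneg_left hdiag (Nat.cast_nonneg _)

end PositiveFrame

open scoped BigOperators
open Literature.Computability.AlgebraicComplexity

/-- **Registered sub-goal `capture_le_card_of_nonneg_frame` (def-free): the monotone regime of `stub_nonnegFlatDecay`.**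
For every flat target `Y` on a finite format and every sum `S` of `r` triads with entrywise NON-NEGATIVE real factors,
`|⟨S,Y⟩|² ≤ r·‖S‖²` — the stub with `c = 1`, `δ = 1/2` (at `r = |ι|`) on the cancellation-free cone, sharp. -/
theorem capture_le_card_of_nonneg_frame :
    ∀ (ι : Type) [Fintype ι] (r : ℕ) (Y : ι → ι → ι → ℂ),
      (∀ w u v : ι → ℂ, ‖∑ i, ∑ j, ∑ k, w i * u j * v k * Y i j k‖ ≤
        Real.sqrt (∑ i, ‖w i‖ ^ 2) * Real.sqrt (∑ j, ‖u j‖ ^ 2) * Real.sqrt (∑ k, ‖v k‖ ^ 2)) →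
      ∀ (a b c : Fin r → ι → ℝ), (∀ l i, 0 ≤ a l i) → (∀ l j, 0 ≤ b l j) → (∀ l k, 0 ≤ c l k) →
        ‖∑ i, ∑ j, ∑ k, ((∑ l, a l i * b l j * c l k : ℝ) : ℂ) * Y i j k‖ ^ 2 ≤
          r * ∑ i, ∑ j, ∑ k, (∑ l, a l i * b l j * c l k) ^ 2 :=
  fun _ _ _ Y hY a b c ha hb hc => PositiveFrame.capture_le Y hY a b c ha hb hc

/-- **Monotone schemes capture at most `1/n` of matrix multiplication.**  For `S = Σ_{l<n²} a_l⊗b_l⊗c_l` with entrywise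
non-negative real factors on the format `Fin n × Fin n`: `|⟨S,⟨n,n,n⟩⟩|² ≤ n²·‖S‖²` — `DiagonalPowerDecay` with `C = 1`,
`δ = 1/2` on the cancellation-free cone (sharp: the slice `⟨n,1,n⟩`), by flatness of `⟨n,n,n⟩` (`stub_matMul_isFlat`). -/
theorem matMul_capture_le_of_nonneg_frame (n : ℕ) (a b c : Fin (n ^ 2) → Fin n × Fin n → ℝ)
    (ha : ∀ l i, 0 ≤ a l i) (hb : ∀ l j, 0 ≤ b l j) (hc : ∀ l k, 0 ≤ c l k) :
    ‖∑ i, ∑ j, ∑ k, ((∑ l, a l i * b l j * c l k : ℝ) : ℂ) * matMulTensor ℂ n n n i j k‖ ^ 2 ≤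
      (n : ℝ) ^ 2 * ∑ i, ∑ j, ∑ k, (∑ l, a l i * b l j * c l k) ^ 2 := by
  have h := capture_le_card_of_nonneg_frame (Fin n × Fin n) (n ^ 2) (matMulTensor ℂ n n n)
    (stub_matMul_isFlat n) a b c ha hb hc
  rw [show ((n ^ 2 : ℕ) : ℝ) = (n : ℝ) ^ 2 by push_cast; ring] at h
  exact h

end Summit.MatrixMultiplication.MatrixMultiplication.Theorems.DiagonalPowerDecay

end
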